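import Literature.NumberTheory.Automorphic.AdelicVectorHeightBound
import Literature.NumberTheory.Automorphic.GLnMaximalCompactCompact
import Literature.NumberTheory.Automorphic.IwasawaDecompositionArchimedean
import HarnessLib

/-!
# Heights of adelic vectors are invariant under `K = K_∞ · GL_n(𝒪̂_K)`
(Garrett, *Modern Analysis of Automorphic Forms by Example* (2018), §2.2, PDF p. 81: "by design,
the isometry groups of the height functions `h_v` are the compact subgroups `K_v`"; proof of
Claim 3.3.2, PDF p. 162: "since `K = K_𝔸 = ∏_v K_v` preserves heights"; Godement, Sém. Bourbaki
257, §1.2: "the canonical height is invariant under `K`")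

Second file of the height machinery of Minkowski reduction for `GL_n` over a number field `K`
(towards `reductionTheory_gl`, Getz–Hahn (2024), Thm. 2.7.2), continuing `AdelicVectorHeight` and
`AdelicVectorHeightBound`.
Everything is proved:

* `vecArchNorm_vecMul_eq_of_isometry` — if the `w`-components of a matrix `k ∈ M_n(𝔸_K)` become a
  unitary matrix under an isometric ring homomorphism `K_w →+* 𝕜` (`𝕜 = ℝ` or `ℂ`), then
  `‖x k‖_w = ‖x‖_w` (the tree's `EuclideanSpace.norm_toLp_vecMul_of_mem_unitaryGroup`);
* `vecArchNorm_vecMul_eq_of_toMixed_mem_Kinf` — the Euclidean norms at the infinite places are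
  invariant under every `k ∈ GL_n(𝔸_K)` whose archimedean component lies in
  `K_∞ = ∏_{w real} O(n) × ∏_{w complex} U(n)` (`Kinf`, `mem_Kinf_iff`), via Mathlib's isometric
  embeddings `extensionEmbeddingOfIsReal`, `extensionEmbedding` of the completions;
* `toMixed_mem_Kinf_of_mem_standardMaximalCompactGL`, `snd_apply_mem_of_mem_standardMaximalCompactGL`
  — for `k ∈ K = K_∞ · GL_n(𝒪̂_K)` (`standardMaximalCompactGL` of `ReductionTheoryGLn`, written as
  the pointwise product by `coe_standardMaximalCompactGL_eq_mul`), the archimedean component lies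
  in `K_∞` and the finite components of the entries of `k` and `k⁻¹` are local integers;
* `vecFinHeight_vecMul_of_mem_standardMaximalCompactGL`, `vecArchNorm_vecMul_of_mem_…`,
  `vecHeight_vecMul_of_mem_standardMaximalCompactGL`, `isHeightFinite_vecMul_iff_of_mem_…` —
  **all local heights, the global height and height-finiteness are invariant under `K`.**

## References

* P. Garrett, *Modern Analysis of Automorphic Forms by Example* (2018), §2.2 (PDF p. 81),
  Claim 3.3.2 (PDF p. 162) [Garrett2018].
* R. Godement, *Domaines fondamentaux des groupes arithmétiques*, Sém. Bourbaki 257 (1962/63),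
  §1.2.
-/

noncomputable section

open scoped NNReal Matrix Classical
open NumberField NumberField.InfinitePlace NumberField.InfinitePlace.Completion
  NumberField.mixedEmbedding IsDedekindDomain

namespace Literature.NumberTheory.Automorphic

section Arch

variable {K : Type} [Field K] [NumberField K] {n : ℕ}

/-- **Unitary matrices preserve the Euclidean norms at an infinite place.** Let
`φ : K_w →+* 𝕜` (`𝕜 = ℝ` or `ℂ`) be an isometric ring homomorphism and `k ∈ M_n(𝔸_K)` a matrix
whose `w`-components `(φ (kᵢⱼ)_w)` form a unitary matrix over `𝕜`; then `‖x k‖_w = ‖x‖_w` for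
every row vector `x ∈ 𝔸_Kⁿ` (`EuclideanSpace.norm_toLp_vecMul_of_mem_unitaryGroup`; Garrett
(2018), §2.2: the isometry group of `h_v` is `K_v`). [cite: Garrett2018, §2.2 (PDF p. 81)] -/
theorem vecArchNorm_vecMul_eq_of_isometry {𝕜 : Type*} [RCLike 𝕜] (w : InfinitePlace K)
    (φ : w.Completion →+* 𝕜) (hφ : Isometry φ) (x : Fin n → AdeleRing (𝓞 K) K)
    (k : Matrix (Fin n) (Fin n) (AdeleRing (𝓞 K) K))
    (hk : (Matrix.of fun i j => φ ((k i j).1 w)) ∈ Matrix.unitaryGroup (Fin n) 𝕜) :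
    vecArchNorm K w (x ᵥ* k) = vecArchNorm K w x := by
  set u : Fin n → 𝕜 := fun i => φ ((x i).1 w) with hu
  set M : Matrix (Fin n) (Fin n) 𝕜 := Matrix.of fun i j => φ ((k i j).1 w) with hM
  have hnorm : ∀ z : w.Completion, ‖φ z‖ = ‖z‖ := (AddMonoidHomClass.isometry_iff_norm φ).1 hφ
  -- the `w`-components of `x k` are the entries of `u M`
  have hcomp : ∀ j, φ (((x ᵥ* k) j).1 w) = (u ᵥ* M) j := by
    intro j
    rw [← AdeleRing.fstEval_apply w, Matrix.vecMul_apply_eq_sum, map_sum, map_sum,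
      Matrix.vecMul_apply_eq_sum]
    refine Finset.sum_congr rfl fun i _ => ?_
    rw [map_mul, map_mul, AdeleRing.fstEval_apply, AdeleRing.fstEval_apply, hM, Matrix.of_apply]
  -- Euclidean norms through `φ`
  have hx : (vecArchNorm K w x : ℝ) = ‖(WithLp.toLp 2 u : EuclideanSpace 𝕜 (Fin n))‖ := by
    rw [EuclideanSpace.norm_eq, vecArchNorm, Real.coe_sqrt, NNReal.coe_sum]
    congr 1
    refine Finset.sum_congr rfl fun i _ => ?_
    rw [PiLp.toLp_apply, hu, hnorm, NNReal.coe_pow, coe_nnnorm]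
  have hxk : (vecArchNorm K w (x ᵥ* k) : ℝ) =
      ‖(WithLp.toLp 2 (u ᵥ* M) : EuclideanSpace 𝕜 (Fin n))‖ := by
    rw [EuclideanSpace.norm_eq, vecArchNorm, Real.coe_sqrt, NNReal.coe_sum]
    congr 1
    refine Finset.sum_congr rfl fun j _ => ?_
    rw [PiLp.toLp_apply, ← hcomp j, hnorm, NNReal.coe_pow, coe_nnnorm]
  apply NNReal.coe_injective
  rw [hxk, hx, EuclideanSpace.norm_toLp_vecMul_of_mem_unitaryGroup u hk]

/-- The entries of the archimedean component `g_∞ = GLn.toMixed g ∈ GL_n(ℝ^{r₁} × ℂ^{r₂})` at a real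
place `w` are the images of the `w`-components of the entries of `g` under the isometric
embedding `K_w →+* ℝ` (Mathlib `ringEquiv_mixedSpace_apply`). [folklore] -/
theorem map_mixedSpaceEvalReal_toMixed_apply (g : GL (Fin n) (AdeleRing (𝓞 K) K))
    (w : {w : InfinitePlace K // w.IsReal}) (i j : Fin n) :
    (Matrix.GeneralLinearGroup.map (mixedSpaceEvalReal K w) (GLn.toMixed n K g) :
        Matrix (Fin n) (Fin n) ℝ) i j =
      extensionEmbeddingOfIsReal w.2 ((((g : Matrix (Fin n) (Fin n) (AdeleRing (𝓞 K) K)) i j).1) w.1) :=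
  rfl

/-- The entries of `g_∞` at a complex place `w` are the images of the `w`-components of the entries
of `g` under the isometric embedding `K_w →+* ℂ`. [folklore] -/
theorem map_mixedSpaceEvalComplex_toMixed_apply (g : GL (Fin n) (AdeleRing (𝓞 K) K))
    (w : {w : InfinitePlace K // w.IsComplex}) (i j : Fin n) :
    (Matrix.GeneralLinearGroup.map (mixedSpaceEvalComplex K w) (GLn.toMixed n K g) :
        Matrix (Fin n) (Fin n) ℂ) i j =
      extensionEmbedding w.1 ((((g : Matrix (Fin n) (Fin n) (AdeleRing (𝓞 K) K)) i j).1) w.1) :=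
  rfl

/-- **The Euclidean norms at the infinite places are invariant under `K_∞`**: if the archimedean
component of `k ∈ GL_n(𝔸_K)` lies in `K_∞ = ∏_{w real} O(n) × ∏_{w complex} U(n)` (`Kinf n K`),
then `‖x k‖_w = ‖x‖_w` for every infinite place `w` and every `x ∈ 𝔸_Kⁿ` (Garrett (2018), §2.2
and proof of Claim 3.3.2). [cite: Garrett2018, Claim 3.3.2 (proof, PDF p. 162)] -/
theorem vecArchNorm_vecMul_eq_of_toMixed_mem_Kinf {k : GL (Fin n) (AdeleRing (𝓞 K) K)}
    (hk : GLn.toMixed n K k ∈ Kinf n K) (w : InfinitePlace K) (x : Fin n → AdeleRing (𝓞 K) K) :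
    vecArchNorm K w (x ᵥ* (k : Matrix (Fin n) (Fin n) (AdeleRing (𝓞 K) K))) = vecArchNorm K w x := by
  rw [mem_Kinf_iff] at hk
  rcases w.isReal_or_isComplex with hw | hw
  · have h := (mem_unitarySubgroupGL_iff_coe_mem_unitaryGroup _).1 (hk.1 ⟨w, hw⟩)
    refine vecArchNorm_vecMul_eq_of_isometry w (extensionEmbeddingOfIsReal hw)
      (isometry_extensionEmbeddingOfIsReal hw) x _ ?_
    have hM : (Matrix.of fun i j => extensionEmbeddingOfIsReal hw
        ((((k : Matrix (Fin n) (Fin n) (AdeleRing (𝓞 K) K)) i j).1) w)) =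
        (Matrix.GeneralLinearGroup.map (mixedSpaceEvalReal K ⟨w, hw⟩) (GLn.toMixed n K k) :
          Matrix (Fin n) (Fin n) ℝ) :=
      Matrix.ext fun i j => (map_mixedSpaceEvalReal_toMixed_apply k ⟨w, hw⟩ i j).symm
    rw [hM]
    exact h
  · have h := (mem_unitarySubgroupGL_iff_coe_mem_unitaryGroup _).1 (hk.2 ⟨w, hw⟩)
    refine vecArchNorm_vecMul_eq_of_isometry w (extensionEmbedding w)
      (isometry_extensionEmbedding w) x _ ?_
    have hM : (Matrix.of fun i j => extensionEmbedding w
        ((((k : Matrix (Fin n) (Fin n) (AdeleRing (𝓞 K) K)) i j).1) w)) =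
        (Matrix.GeneralLinearGroup.map (mixedSpaceEvalComplex K ⟨w, hw⟩) (GLn.toMixed n K k) :
          Matrix (Fin n) (Fin n) ℂ) :=
      Matrix.ext fun i j => (map_mixedSpaceEvalComplex_toMixed_apply k ⟨w, hw⟩ i j).symm
    rw [hM]
    exact h

end Arch

section Compact

variable {K : Type} [Field K] [NumberField K] {n : ℕ}

/-- For `k ∈ K = K_∞ · GL_n(𝒪̂_K)` the archimedean component `k_∞` lies in `K_∞`
(`k = (κ, 1) · (1, h)` with `κ ∈ K_∞`, `h ∈ GL_n(𝒪̂_K)`, and `(1, h)_∞ = 1`). [folklore] -/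
theorem toMixed_mem_Kinf_of_mem_standardMaximalCompactGL {k : GL (Fin n) (AdeleRing (𝓞 K) K)}
    (hk : k ∈ standardMaximalCompactGL n K) : GLn.toMixed n K k ∈ Kinf n K := by
  have hk' : k ∈ (standardMaximalCompactGL n K : Set (GL (Fin n) (AdeleRing (𝓞 K) K))) := hk
  rw [coe_standardMaximalCompactGL_eq_mul] at hk'
  obtain ⟨a, ha, b, hb, rfl⟩ := Set.mem_mul.1 hk'
  obtain ⟨κ, hκ, rfl⟩ := Subgroup.mem_map.1 ha
  have hb1 : GLn.toMixed n K b = 1 := by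
    rw [GLn.toMixed_apply, (mem_glIntegralLevel_iff.1 hb).2, map_one]
  rw [map_mul, GLn.toMixed_ofInfinite, hb1, mul_one]
  exact hκ

/-- For `k ∈ K = K_∞ · GL_n(𝒪̂_K)` the finite part of `k` lies in `GL_n(𝒪̂_K)`. [folklore] -/
theorem sndHom_mem_of_mem_standardMaximalCompactGL {k : GL (Fin n) (AdeleRing (𝓞 K) K)}
    (hk : k ∈ standardMaximalCompactGL n K) : GLn.sndHom n K k ∈ glFiniteIntegralLevel n K := by
  have hk' : k ∈ (standardMaximalCompactGL n K : Set (GL (Fin n) (AdeleRing (𝓞 K) K))) := hk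
  rw [coe_standardMaximalCompactGL_eq_mul] at hk'
  obtain ⟨a, ha, b, hb, rfl⟩ := Set.mem_mul.1 hk'
  obtain ⟨κ, -, rfl⟩ := Subgroup.mem_map.1 ha
  rw [map_mul, GLn.sndHom_ofInfinite, one_mul]
  exact (mem_glIntegralLevel_iff.1 hb).1

/-- For `k ∈ K = K_∞ · GL_n(𝒪̂_K)`, the finite components of the entries of `k` and of `k⁻¹` are
local integers at every finite place. [folklore] -/
theorem snd_apply_mem_of_mem_standardMaximalCompactGL {k : GL (Fin n) (AdeleRing (𝓞 K) K)}
    (hk : k ∈ standardMaximalCompactGL n K) (v : HeightOneSpectrum (𝓞 K)) (i j : Fin n) :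
    (((k : Matrix (Fin n) (Fin n) (AdeleRing (𝓞 K) K)) i j).2 v ∈ v.adicCompletionIntegers K) ∧
      ((((k⁻¹ : GL (Fin n) (AdeleRing (𝓞 K) K)) : Matrix (Fin n) (Fin n) (AdeleRing (𝓞 K) K)) i j).2 v ∈
        v.adicCompletionIntegers K) := by
  have h := mem_glFiniteIntegralLevel_iff.1 (sndHom_mem_of_mem_standardMaximalCompactGL hk)
  refine ⟨?_, ?_⟩
  · exact mem_integralFiniteAdeles_iff.1 (h.1 i j) v
  · have h2 := h.2 i j
    rw [← map_inv] at h2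
    exact mem_integralFiniteAdeles_iff.1 h2 v

/-- **The finite local heights are invariant under `K`** (`GL_n(𝒪_v)` at each finite place;
Garrett (2018), §2.2). [cite: Garrett2018, §2.2 (PDF p. 81)] -/
theorem vecFinHeight_vecMul_of_mem_standardMaximalCompactGL {k : GL (Fin n) (AdeleRing (𝓞 K) K)}
    (hk : k ∈ standardMaximalCompactGL n K) (v : HeightOneSpectrum (𝓞 K))
    (x : Fin n → AdeleRing (𝓞 K) K) :
    vecFinHeight K v (x ᵥ* (k : Matrix (Fin n) (Fin n) (AdeleRing (𝓞 K) K))) = vecFinHeight K v x :=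
  vecFinHeight_vecMul_eq_of_forall_mem v x k
    (fun i j => (snd_apply_mem_of_mem_standardMaximalCompactGL hk v i j).1)
    (fun i j => (snd_apply_mem_of_mem_standardMaximalCompactGL hk v i j).2)

/-- **The Euclidean norms at the infinite places are invariant under `K`** (`O(n)` / `U(n)` at each
infinite place; Garrett (2018), §2.2). [cite: Garrett2018, §2.2 (PDF p. 81)] -/
theorem vecArchNorm_vecMul_of_mem_standardMaximalCompactGL {k : GL (Fin n) (AdeleRing (𝓞 K) K)}
    (hk : k ∈ standardMaximalCompactGL n K) (w : InfinitePlace K) (x : Fin n → AdeleRing (𝓞 K) K) :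
    vecArchNorm K w (x ᵥ* (k : Matrix (Fin n) (Fin n) (AdeleRing (𝓞 K) K))) = vecArchNorm K w x :=
  vecArchNorm_vecMul_eq_of_toMixed_mem_Kinf (toMixed_mem_Kinf_of_mem_standardMaximalCompactGL hk) w x

/-- **The height is invariant under `K = K_∞ · GL_n(𝒪̂_K)`**: `h(x k) = h(x)` for `k ∈ K` and every
`x ∈ 𝔸_Kⁿ` (Godement, Sém. Bourbaki 257, §1.2: "the canonical height is invariant under `K`";
Garrett (2018), proof of Claim 3.3.2: "`K = K_𝔸` preserves heights").
[cite: Garrett2018, Claim 3.3.2 (proof, PDF p. 162)] -/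
theorem vecHeight_vecMul_of_mem_standardMaximalCompactGL {k : GL (Fin n) (AdeleRing (𝓞 K) K)}
    (hk : k ∈ standardMaximalCompactGL n K) (x : Fin n → AdeleRing (𝓞 K) K) :
    vecHeight K (x ᵥ* (k : Matrix (Fin n) (Fin n) (AdeleRing (𝓞 K) K))) = vecHeight K x := by
  rw [vecHeight, vecHeight]
  simp_rw [vecArchNorm_vecMul_of_mem_standardMaximalCompactGL hk,
    vecFinHeight_vecMul_of_mem_standardMaximalCompactGL hk]

/-- Height-finiteness is invariant under `K`. [folklore] -/
theorem isHeightFinite_vecMul_iff_of_mem_standardMaximalCompactGL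
    {k : GL (Fin n) (AdeleRing (𝓞 K) K)} (hk : k ∈ standardMaximalCompactGL n K)
    (x : Fin n → AdeleRing (𝓞 K) K) :
    IsHeightFinite K (x ᵥ* (k : Matrix (Fin n) (Fin n) (AdeleRing (𝓞 K) K))) ↔ IsHeightFinite K x := by
  rw [IsHeightFinite, IsHeightFinite]
  simp_rw [vecFinHeight_vecMul_of_mem_standardMaximalCompactGL hk]

end Compact

end Literature.NumberTheory.Automorphic
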